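import Summits.SmoothPoincare4.SmoothPoincare4.Theorems.SymplecticOrigamiGromovRecognitionRelEndHelperLocalIndexOfSection
import Summits.SmoothPoincare4.SmoothPoincare4.Theorems.SymplecticOrigamiGromovRecognitionRelEndHelperWVecDerivAlongCurve
import Summits.SmoothPoincare4.SmoothPoincare4.Theorems.SymplecticOrigamiGromovRecognitionRelEndHelperWindAtSimpleZero
import Summits.SmoothPoincare4.SmoothPoincare4.Theorems.SymplecticOrigamiGromovRecognitionRelEndHelperFrameIndexInvariance
import Summits.SmoothPoincare4.SmoothPoincare4.Theorems.SymplecticOrigamiGromovRecognitionRelEndHelperNwtCrossingAlgebra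
import Literature.Topology.FourManifolds.NullhomotopicNormalFraming
import Literature.Topology.FourManifolds.ProjectiveLineRotationField
import Literature.Topology.FourManifolds.OrientationSign

/-!
# The local index at a transverse crossing of an embedded sphere with a push-off of another
(registered helper `helper_nwtCrossingIndex`, line `cross-cap-laurent`, crux `GromovRecognitionRelEnd`, stmt-SmoothPoincare4-11009;
heart of the child stub `stub_normalWitnessTransfer` of `AdjunctionEmbeddedSpheres`, stmt-16775 / item 18059).
`D : CodimTwoData 2 X ℂℙ¹ ℝᵐ` (embedded sphere `Σ`), its Kirby plane field with rotation field `Rot` and tautological section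
`sec`; a second surface `K = Φ(ℂ × {s})` (`Φ` an immersion with `g ∘ Φ = pr₂`) crossing `Σ` transversally at `Φ (ζ₀, s) = u z₀`.
Claim: `d q ≠ 0` with `wind (φ ∘ circle) = sign d` (coordinates `φ` of `sec` along `K` in a frame `t`), `wind ((g ∘ u - s) ∘ circle)
= sign q`, and `d · det[du | N] = ‖τ‖⁴ · det[dΦ] · q`.  Steps: (A) `w = (wVec ∘ e ∘ γ, 0)` vanishes at `ζ₀` with injective
derivative `(Q ∘ d(e ∘ γ), 0)` (`helper_wVecDerivAlongCurve`, transversality via `mem_TS_of_Q_apply_eq_zero`); (B) local frame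
`t' = (Q_{nearPt} τ, 0)`, `helper_localIndexOfSection`; (C) `helper_frameIndexInvariance` to the frame `t`, and `sec = ‖wVec‖⁻¹ w`
(positive factor, winding `0`); (D) `helper_windAtSimpleZero` for `g ∘ u - s`; (E) `helper_nwtCrossingAlgebra` with `α = du`,
`β = dΦ(·,0)`, `L = dΦ(0,·)`, `μ = dg`.  Kirby 1989 Ch. VIII Thm. 2; Guillemin–Pollack 1974 Ch. 3 §3.  No new definitions.
-/

noncomputable section

open scoped Manifold ContDiff Topology
open Set Function Metric Literature.Topology.FourManifolds Literature.Topology.PlaneTopology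
  Literature.Topology.FourManifolds.NormalEuler

set_option linter.dupNamespace false

namespace Summit.SmoothPoincare4.SmoothPoincare4.Theorems.GromovRecognitionRelEnd.CrossCapLaurent

set_option maxHeartbeats 800000 in
/-- **Local index at a transverse crossing** of the push-off `K = Φ(ℂ × {s})` with the embedded sphere
`Σ`: the winding number of the tautological section of the plane field of `Σ` along `K` about the crossing,
the winding number of `g ∘ u - s` about the crossing parameter of `Σ`, and the determinant identity tying
their signs to the two frame determinants. [cite: Kirby1989, Ch. VIII, Thm. 2] -/
theorem helper_nwtCrossingIndex : ∀ (m : ℕ) (X : Type) [TopologicalSpace X] [T2Space X] [SecondCountableTopology X] [ChartedSpace (EuclideanSpace ℝ (Fin 4)) X] [IsManifold (𝓡 4) ∞ X] (D : Literature.Topology.FourManifolds.CodimTwoData 2 X (Literature.Topology.FourManifolds.ComplexProjectiveSpace 1) (EuclideanSpace ℝ (Fin m))) (J : Literature.Topology.FourManifolds.ComplexProjectiveSpace 1 → EuclideanSpace ℝ (Fin m) →L[ℝ] EuclideanSpace ℝ (Fin m)) (ε δ : ℝ) (Rot : EuclideanSpace ℝ (Fin m) → (EuclideanSpace ℝ (Fin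 m) × EuclideanSpace ℝ (Fin 2)) →L[ℝ] (EuclideanSpace ℝ (Fin m) × EuclideanSpace ℝ (Fin 2))) (sec : EuclideanSpace ℝ (Fin m) → EuclideanSpace ℝ (Fin m) × EuclideanSpace ℝ (Fin 2)) (Φ : ℂ × ℂ → X) (g : X → ℂ) (UK : Set X) (u : ℂ → X) (s ζ₀ z₀ : ℂ) (τ : EuclideanSpace ℝ (Fin m)) (N₁ N₂ : EuclideanSpace ℝ (Fin 4)) (t : ℂ → EuclideanSpace ℝ (Fin m) × EuclideanSpace ℝ (Fin 2)) (φ : ℂ → ℂ) (ρ₀ : ℝ) (bE : Module.Basis (Fin 4) ℝ (EuclideanSpace ℝ (Fin 4))), D.IsRotationField J → D.IsTubeRadius ε → 0 < δ → δ ≤ ε → ContinuousOn (D.planeField J ε δ) (Set.range D.e) → ContinuousOn Rot (Set.range D.e) → (∀ z ∈ Set.range D.e, (∀ v, D.planeField J ε δ z (D.planeField J ε δ z v) = D.planeField J ε δ z v) ∧ (∀ v, D.planeField J ε δ z (Rot z v) = Rot z v) ∧ (∀ v, Rot z (D.planeField J ε δ z v) = Rot z v) ∧ (∀ v, Rot z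 (Rot z v) = - D.planeField J ε δ z v) ∧ (∀ v, inner ℝ (Rot z v).1 (D.planeField J ε δ z v).1 + inner ℝ (Rot z v).2 (D.planeField J ε δ z v).2 = 0) ∧ (∀ v, inner ℝ (Rot z v).1 (Rot z v).1 + inner ℝ (Rot z v).2 (Rot z v).2 = inner ℝ (D.planeField J ε δ z v).1 (D.planeField J ε δ z v).1 + inner ℝ (D.planeField J ε δ z v).2 (D.planeField J ε δ z v).2) ∧ D.planeField J ε δ z ≠ 0 ∧ (∀ v w', D.planeField J ε δ z v = v → v ≠ 0 → D.planeField J ε δ z w' = w' → w' = ((inner ℝ w'.1 v.1 + inner ℝ w'.2 v.2) / (inner ℝ v.1 v.1 + inner ℝ v.2 v.2)) • v + ((inner ℝ w'.1 (Rot z v).1 + inner ℝ w'.2 (Rot z v).2) / (inner ℝ v.1 v.1 + inner ℝ v.2 v.2)) • Rot z v)) → (∀ z, Metric.infDist z D.img ≤ δ / 2 → ∀ v, Rot z v = (J (D.nearPt ε z) (D.Q (D.nearPt ε z) v.1), 0)) → (∀ z, Metric.infDist z D.img ≤ δ / 2 → sec z = (‖D.wVec ε z‖⁻¹ • D.wVec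 ε z, 0)) → ContMDiff 𝓘(ℝ, ℂ × ℂ) (𝓡 4) ∞ Φ → (∀ q, Function.Injective (mfderiv 𝓘(ℝ, ℂ × ℂ) (𝓡 4) Φ q)) → IsOpen UK → ContMDiffOn (𝓡 4) 𝓘(ℝ, ℂ) ∞ g UK → (∀ q, Φ q ∈ UK) → (∀ q, g (Φ q) = q.2) → ContMDiff 𝓘(ℝ, ℂ) (𝓡 4) ∞ u → (∀ z, D.b (Literature.Topology.FourManifolds.CodimTwoData.linePt 0 z) = u z) → Φ (ζ₀, s) = u z₀ → Function.Surjective (mfderiv 𝓘(ℝ, ℂ) 𝓘(ℝ, ℂ) (fun z => g (u z)) z₀) → τ ∈ D.F (Literature.Topology.FourManifolds.CodimTwoData.linePt 0 z₀) → τ ≠ 0 → mfderiv (𝓡 4) 𝓘(ℝ, EuclideanSpace ℝ (Fin m)) D.e (u z₀) N₁ = τ → mfderiv (𝓡 4) 𝓘(ℝ, EuclideanSpace ℝ (Fin m)) D.e (u z₀) N₂ = J (Literature.Topology.FourManifolds.CodimTwoData.linePt 0 z₀) τ → 0 < ρ₀ → ContinuousOn t (Metric.ball ζ₀ ρ₀)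 → (∀ ζ ∈ Metric.ball ζ₀ ρ₀, D.planeField J ε δ (D.e (Φ (ζ, s))) (t ζ) = t ζ ∧ t ζ ≠ 0) → (∀ ζ, φ ζ = ((inner ℝ (sec (D.e (Φ (ζ, s)))).1 (t ζ).1 + inner ℝ (sec (D.e (Φ (ζ, s)))).2 (t ζ).2 : ℝ) : ℂ) + ((inner ℝ (sec (D.e (Φ (ζ, s)))).1 (Rot (D.e (Φ (ζ, s))) (t ζ)).1 + inner ℝ (sec (D.e (Φ (ζ, s)))).2 (Rot (D.e (Φ (ζ, s))) (t ζ)).2 : ℝ) : ℂ) * Complex.I) → ∃ (d q r₀ : ℝ), d ≠ 0 ∧ q ≠ 0 ∧ 0 < r₀ ∧ d * bE.det ![mfderiv 𝓘(ℝ, ℂ) (𝓡 4) u z₀ (1 : ℂ), mfderiv 𝓘(ℝ, ℂ) (𝓡 4) u z₀ Complex.I, N₁, N₂] = ‖τ‖ ^ 4 * (bE.det ![mfderiv 𝓘(ℝ, ℂ × ℂ) (𝓡 4) Φ (ζ₀, s) (1, 0), mfderiv 𝓘(ℝ, ℂ × ℂ) (𝓡 4) Φ (ζ₀, s) (Complex.I,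 0), mfderiv 𝓘(ℝ, ℂ × ℂ) (𝓡 4) Φ (ζ₀, s) (0, 1), mfderiv 𝓘(ℝ, ℂ × ℂ) (𝓡 4) Φ (ζ₀, s) (0, Complex.I)] * q) ∧ (∀ r : ℝ, 0 < r → r ≤ r₀ → Literature.Topology.PlaneTopology.IsNonvanishingLoop (fun θ => φ (Literature.Topology.PlaneTopology.circleLoop ζ₀ r θ)) ∧ Literature.Topology.PlaneTopology.wind (fun θ => φ (Literature.Topology.PlaneTopology.circleLoop ζ₀ r θ)) = (if 0 < d then 1 else -1)) ∧ (∀ r : ℝ, 0 < r → r ≤ r₀ → Literature.Topology.PlaneTopology.wind (fun θ => g (u (Literature.Topology.PlaneTopology.circleLoop z₀ r θ)) - s) = (if 0 < q then 1 else -1)) := by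
  intro m X _ _ _ _ _ D J ε δ Rot sec Φ g UK u s ζ₀ z₀ τ N₁ N₂ t φ ρ₀ bE hJ hε hδ hδε hPc hRotc hOPF hRotIn
    hSecIn hΦ hΦd hUK hg hΦU hgΦ hu hbu hcross hreg hτF hτ0 hN₁ hN₂ hρ₀ htc ht hφ
  classical
  -- notation and basic identifications
  set x₀ : ComplexProjectiveSpace 1 := CodimTwoData.linePt 0 z₀ with hx₀
  set γ : ℂ → X := fun ζ => Φ (ζ, s) with hγdef
  have hιs : ContMDiff 𝓘(ℝ, ℂ) 𝓘(ℝ, ℂ × ℂ) ∞ (fun ζ : ℂ => (ζ, s)) := contMDiff_iff_contDiff.2 (contDiff_id.prodMk contDiff_const)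
  have hγs : ContMDiff 𝓘(ℝ, ℂ) (𝓡 4) ∞ γ := hΦ.comp hιs
  have hbx₀ : D.b x₀ = u z₀ := hbu z₀
  have hγ₀ : γ ζ₀ = D.b x₀ := hcross.trans hbx₀.symm
  have heγ₀ : D.e (γ ζ₀) = D.f x₀ := by rw [hγ₀]; rfl
  have hQτ : D.Q x₀ τ = τ := Submodule.starProjection_eq_self_iff.2 hτF
  have hQτ' : D.Q x₀ (J x₀ τ) = J x₀ τ := Submodule.starProjection_eq_self_iff.2 (hJ.apply_mem x₀ τ)
  have hx₀near : D.nearPt ε (D.e (γ ζ₀)) = x₀ := by rw [heγ₀, D.nearPt_f hε]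
  have hinf₀ : infDist (D.e (γ ζ₀)) D.img = 0 := by rw [heγ₀]; exact D.infDist_f_img x₀
  -- the curve in the Whitney picture, the tautological section along it and its derivative
  set eγ : ℂ → EuclideanSpace ℝ (Fin m) := fun ζ => D.e (γ ζ) with heγdef
  have heγs : ContMDiff 𝓘(ℝ, ℂ) 𝓘(ℝ, EuclideanSpace ℝ (Fin m)) ∞ eγ := D.he.comp hγs
  have heγc : Continuous eγ := heγs.continuous
  set A : ℂ →L[ℝ] EuclideanSpace ℝ (Fin m) := mfderiv 𝓘(ℝ, ℂ) 𝓘(ℝ, EuclideanSpace ℝ (Fin m)) eγ ζ₀ with hAdef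
  have hwd : HasFDerivAt (fun ζ => D.wVec ε (eγ ζ)) ((D.Q x₀).comp A) ζ₀ := helper_wVecDerivAlongCurve 2 m X (ComplexProjectiveSpace 1) D ε γ ζ₀ x₀ hε hγs hγ₀
  set w : ℂ → EuclideanSpace ℝ (Fin m) × EuclideanSpace ℝ (Fin 2) := fun ζ => (D.wVec ε (eγ ζ), 0) with hwdef
  set L₀ : ℂ →L[ℝ] EuclideanSpace ℝ (Fin m) × EuclideanSpace ℝ (Fin 2) := ((D.Q x₀).comp A).prod 0 with hL₀def
  have hwd' : HasFDerivAt w L₀ ζ₀ := hwd.prodMk (hasFDerivAt_const (0 : EuclideanSpace ℝ (Fin 2)) ζ₀)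
  have hw₀ : w ζ₀ = 0 := by
    simp only [hwdef, heγdef, heγ₀, D.wVec_f hε]
    rfl
  -- the chain rule `A = de ∘ dγ`, and `dγ h = dΦ (h, 0)`
  have hγd : ∀ ζ, HasMFDerivAt 𝓘(ℝ, ℂ) (𝓡 4) γ ζ ((mfderiv 𝓘(ℝ, ℂ × ℂ) (𝓡 4) Φ (ζ, s)).comp (ContinuousLinearMap.inl ℝ ℂ ℂ)) := by
    intro ζ
    have h1 : HasMFDerivAt 𝓘(ℝ, ℂ) 𝓘(ℝ, ℂ × ℂ) (fun ζ : ℂ => (ζ, s)) ζ (ContinuousLinearMap.inl ℝ ℂ ℂ) := hasMFDerivAt_iff_hasFDerivAt.2 ((hasFDerivAt_id ζ).prodMk (hasFDerivAt_const s ζ))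
    exact ((hΦ (ζ, s)).mdifferentiableAt (by simp)).hasMFDerivAt.comp ζ h1
  set β : ℂ →L[ℝ] EuclideanSpace ℝ (Fin 4) := (mfderiv 𝓘(ℝ, ℂ × ℂ) (𝓡 4) Φ (ζ₀, s)).comp (ContinuousLinearMap.inl ℝ ℂ ℂ) with hβdef
  set Lr : ℂ →L[ℝ] EuclideanSpace ℝ (Fin 4) := (mfderiv 𝓘(ℝ, ℂ × ℂ) (𝓡 4) Φ (ζ₀, s)).comp (ContinuousLinearMap.inr ℝ ℂ ℂ) with hLrdef
  set de : EuclideanSpace ℝ (Fin 4) →L[ℝ] EuclideanSpace ℝ (Fin m) := mfderiv (𝓡 4) 𝓘(ℝ, EuclideanSpace ℝ (Fin m)) D.e (D.b x₀) with hdedef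
  have hN₁' : de N₁ = τ := by rw [hdedef, hbx₀]; exact hN₁
  have hN₂' : de N₂ = J x₀ τ := by rw [hdedef, hbx₀]; exact hN₂
  have hA : ∀ h, A h = de (β h) := by
    intro h
    have h1 : HasMFDerivAt 𝓘(ℝ, ℂ) 𝓘(ℝ, EuclideanSpace ℝ (Fin m)) eγ ζ₀ (de.comp β) := by
      have he1 : HasMFDerivAt (𝓡 4) 𝓘(ℝ, EuclideanSpace ℝ (Fin m)) D.e (γ ζ₀) de := by
        rw [hdedef, ← hγ₀]
        exact (D.mdifferentiableAt_e _).hasMFDerivAt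
      exact he1.comp ζ₀ (hγd ζ₀)
    rw [hAdef, h1.mfderiv]
    rfl
  -- `g ∘ Φ = pr₂`: `dg` at the crossing kills `dΦ (·, 0)` and inverts `dΦ (0, ·)`
  have hmemUK : u z₀ ∈ UK := hcross ▸ hΦU (ζ₀, s)
  have hgd : MDifferentiableAt (𝓡 4) 𝓘(ℝ, ℂ) g (u z₀) := (hg.contMDiffAt (hUK.mem_nhds hmemUK)).mdifferentiableAt (by simp)
  set μ : EuclideanSpace ℝ (Fin 4) →L[ℝ] ℂ := mfderiv (𝓡 4) 𝓘(ℝ, ℂ) g (u z₀) with hμdef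
  have hμΦ : ∀ v : ℂ × ℂ, μ (mfderiv 𝓘(ℝ, ℂ × ℂ) (𝓡 4) Φ (ζ₀, s) v) = v.2 := by
    intro v
    have hgd' : HasMFDerivAt (𝓡 4) 𝓘(ℝ, ℂ) g (Φ (ζ₀, s)) μ := by
      rw [hcross]
      exact hgd.hasMFDerivAt
    have h1 : HasMFDerivAt 𝓘(ℝ, ℂ × ℂ) 𝓘(ℝ, ℂ) (g ∘ Φ) (ζ₀, s) (μ.comp (mfderiv 𝓘(ℝ, ℂ × ℂ) (𝓡 4) Φ (ζ₀, s))) := hgd'.comp (ζ₀, s) ((hΦ _).mdifferentiableAt (by simp)).hasMFDerivAt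
    have h2 : (g ∘ Φ) = (Prod.snd : ℂ × ℂ → ℂ) := funext fun q => hgΦ q
    have h3 : HasMFDerivAt 𝓘(ℝ, ℂ × ℂ) 𝓘(ℝ, ℂ) (Prod.snd : ℂ × ℂ → ℂ) (ζ₀, s) (ContinuousLinearMap.snd ℝ ℂ ℂ) := hasMFDerivAt_iff_hasFDerivAt.2 hasFDerivAt_snd
    rw [h2] at h1
    have h4 : μ.comp (mfderiv 𝓘(ℝ, ℂ × ℂ) (𝓡 4) Φ (ζ₀, s)) = ContinuousLinearMap.snd ℝ ℂ ℂ := h1.mfderiv.symm.trans h3.mfderiv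
    exact congrArg (fun T : ℂ × ℂ →L[ℝ] ℂ => T v) h4
  have hμβ : ∀ h, μ (β h) = 0 := fun h => hμΦ (h, 0)
  have hμL : ∀ c, μ (Lr c) = c := fun c => hμΦ (0, c)
  -- near `x₀` the sphere map is `u` read in the affine chart, so `range db ⊆ range du`
  have hcoord : ContMDiffAt (𝓡 2) 𝓘(ℝ, ℂ) ∞
      (fun p : ComplexProjectiveSpace 1 => ComplexProjectiveSpace.affineCoordComplex 0 p 0) x₀ := (Literature.Geometry.Symplectic.contMDiffOn_affineCoordComplex 0).contMDiffAt
      ((ComplexProjectiveSpace.isOpen_setOf_coordNeZero 0).mem_nhds (CodimTwoData.coordNeZero_linePt 0 z₀))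
  have hbloc : D.b =ᶠ[𝓝 x₀] (u ∘ fun p : ComplexProjectiveSpace 1 => ComplexProjectiveSpace.affineCoordComplex 0 p 0) := by
    filter_upwards [(ComplexProjectiveSpace.isOpen_setOf_coordNeZero 0).mem_nhds (CodimTwoData.coordNeZero_linePt 0 z₀)] with p hp
    show D.b p = u (ComplexProjectiveSpace.affineCoordComplex 0 p 0)
    rw [← hbu, CodimTwoData.linePt_affineCoordComplex hp]
  have hdb : ∀ c, ∃ k : ℂ, mfderiv (𝓡 2) (𝓡 4) D.b x₀ c = mfderiv 𝓘(ℝ, ℂ) (𝓡 4) u z₀ k := by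
    intro c
    have hz : ComplexProjectiveSpace.affineCoordComplex 0 x₀ 0 = z₀ := CodimTwoData.affineCoordComplex_linePt 0 z₀
    have hu1 : HasMFDerivAt 𝓘(ℝ, ℂ) (𝓡 4) u (ComplexProjectiveSpace.affineCoordComplex 0 x₀ 0) (mfderiv 𝓘(ℝ, ℂ) (𝓡 4) u z₀) := by
      rw [hz]
      exact ((hu z₀).mdifferentiableAt (by simp)).hasMFDerivAt
    have h1 := hu1.comp x₀ (hcoord.mdifferentiableAt (by simp)).hasMFDerivAt
    have h2 := h1.congr_of_eventuallyEq hbloc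
    exact ⟨mfderiv (𝓡 2) 𝓘(ℝ, ℂ) (fun p : ComplexProjectiveSpace 1 => ComplexProjectiveSpace.affineCoordComplex 0 p 0) x₀ c, by rw [h2.mfderiv]; rfl⟩
  -- transversality: the linearised tautological section is injective
  have hL₀inj : Injective L₀ := by
    intro h₁ h₂ hh
    have hq : D.Q x₀ (A h₁) = D.Q x₀ (A h₂) := by
      have := congrArg Prod.fst hh
      simpa [hL₀def] using this
    have hh' : D.Q x₀ (A (h₁ - h₂)) = 0 := by rw [map_sub, map_sub, hq, sub_self]
    have hTX : A (h₁ - h₂) ∈ D.TX x₀ := by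
      rw [hA]
      exact ⟨β (h₁ - h₂), rfl⟩
    have hTS : A (h₁ - h₂) ∈ D.TS x₀ := D.mem_TS_of_Q_apply_eq_zero hTX hh'
    obtain ⟨c, hc⟩ := (D.mem_TS_iff).1 hTS
    obtain ⟨k, hk⟩ := hdb c
    have h4 : β (h₁ - h₂) = mfderiv 𝓘(ℝ, ℂ) (𝓡 4) u z₀ k := by
      apply D.hde (D.b x₀)
      show de (β (h₁ - h₂)) = de (mfderiv 𝓘(ℝ, ℂ) (𝓡 4) u z₀ k)
      rw [← hA, ← hc, D.mfderiv_f_apply, hk]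
      exact rfl
    have h5 : mfderiv 𝓘(ℝ, ℂ) 𝓘(ℝ, ℂ) (fun z => g (u z)) z₀ k = 0 := by
      have hcomp : mfderiv 𝓘(ℝ, ℂ) 𝓘(ℝ, ℂ) (g ∘ u) z₀ = μ.comp (mfderiv 𝓘(ℝ, ℂ) (𝓡 4) u z₀) := mfderiv_comp z₀ hgd ((hu z₀).mdifferentiableAt (by simp))
      have hk' : mfderiv 𝓘(ℝ, ℂ) 𝓘(ℝ, ℂ) (g ∘ u) z₀ k = (μ.comp (mfderiv 𝓘(ℝ, ℂ) (𝓡 4) u z₀)) k := DFunLike.congr_fun hcomp k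
      have hk'' : (μ.comp (mfderiv 𝓘(ℝ, ℂ) (𝓡 4) u z₀)) k = 0 := by
        show μ (mfderiv 𝓘(ℝ, ℂ) (𝓡 4) u z₀ k) = 0
        rw [← h4]
        exact hμβ _
      exact hk'.trans hk''
    have h6 : k = 0 := by
      have hinj : Injective (mfderiv 𝓘(ℝ, ℂ) 𝓘(ℝ, ℂ) (fun z => g (u z)) z₀) := (LinearMap.injective_iff_surjective (f := (mfderiv 𝓘(ℝ, ℂ) 𝓘(ℝ, ℂ) (fun z => g (u z)) z₀).toLinearMap)).2 hreg
      exact hinj (h5.trans (map_zero _).symm)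
    have h7 : β (h₁ - h₂) = 0 := by
      rw [h4, h6]
      exact map_zero (mfderiv 𝓘(ℝ, ℂ) (𝓡 4) u z₀)
    have h8 : ((h₁ - h₂ : ℂ), (0 : ℂ)) = (0 : ℂ × ℂ) := hΦd (ζ₀, s) (h7.trans (map_zero (mfderiv 𝓘(ℝ, ℂ × ℂ) (𝓡 4) Φ (ζ₀, s))).symm)
    exact sub_eq_zero.1 (congrArg Prod.fst h8)
  -- STEP B: the local oriented plane field along `γ`, the transported normal vector, the local index
  set O₁ : Set ℂ := eγ ⁻¹' {z | infDist z D.img < δ / 2} with hO₁def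
  have hO₁ : IsOpen O₁ := (D.isOpen_setOf_infDist_lt (δ / 2)).preimage heγc
  have hζ₀O₁ : ζ₀ ∈ O₁ := by
    show infDist (eγ ζ₀) D.img < δ / 2
    rw [show eγ ζ₀ = D.e (γ ζ₀) from rfl, hinf₀]
    positivity
  have hmaps : MapsTo eγ O₁ {z | infDist z D.img < ε} := fun ζ hζ =>
    lt_of_lt_of_le (lt_of_lt_of_le hζ (by linarith)) hδε
  have hnc : ContinuousOn (fun ζ => D.Q (D.nearPt ε (eγ ζ))) O₁ := D.contMDiff_Q.continuous.comp_continuousOn ((D.continuousOn_nearPt hε).comp heγc.continuousOn hmaps)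
  have hn0 : D.Q (D.nearPt ε (eγ ζ₀)) τ ≠ 0 := by
    rw [show eγ ζ₀ = D.e (γ ζ₀) from rfl, hx₀near, hQτ]
    exact hτ0
  obtain ⟨ρ₁, hρ₁, hρ₁sub⟩ : ∃ ρ₁ > 0, ball ζ₀ ρ₁ ⊆ (O₁ ∩ {ζ | D.Q (D.nearPt ε (eγ ζ)) τ ≠ 0}) ∩ ball ζ₀ ρ₀ := by
    have hca : ContinuousAt (fun ζ => D.Q (D.nearPt ε (eγ ζ)) τ) ζ₀ := ((hnc.continuousAt (hO₁.mem_nhds hζ₀O₁)).clm_apply continuousAt_const)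
    have hev : ∀ᶠ ζ in 𝓝 ζ₀, ζ ∈ O₁ ∧ D.Q (D.nearPt ε (eγ ζ)) τ ≠ 0 := by
      filter_upwards [hO₁.mem_nhds hζ₀O₁, hca.eventually_ne hn0] with ζ h1 h2
      exact ⟨h1, h2⟩
    obtain ⟨ρ, hρ, hball⟩ := Metric.eventually_nhds_iff_ball.1 hev
    refine ⟨min ρ ρ₀, lt_min hρ hρ₀, fun ζ hζ => ⟨?_, ball_subset_ball (min_le_right _ _) hζ⟩⟩
    exact hball ζ (ball_subset_ball (min_le_left _ _) hζ)
  have hin : ∀ ζ ∈ ball ζ₀ ρ₁, infDist (eγ ζ) D.img ≤ δ / 2 := fun ζ hζ => le_of_lt (hρ₁sub hζ).1.1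
  have htube : ∀ ζ ∈ ball ζ₀ ρ₁, infDist (eγ ζ) D.img < ε := fun ζ hζ => hmaps (hρ₁sub hζ).1.1
  have hn0' : ∀ ζ ∈ ball ζ₀ ρ₁, D.Q (D.nearPt ε (eγ ζ)) τ ≠ 0 := fun ζ hζ => (hρ₁sub hζ).1.2
  have hρ₁ρ₀ : ball ζ₀ ρ₁ ⊆ ball ζ₀ ρ₀ := fun ζ hζ => (hρ₁sub hζ).2
  set P' : ℂ → (EuclideanSpace ℝ (Fin m) × EuclideanSpace ℝ (Fin 2)) →L[ℝ] (EuclideanSpace ℝ (Fin m) × EuclideanSpace ℝ (Fin 2)) := fun ζ => D.planeField J ε δ (eγ ζ) with hP'def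
  set R' : ℂ → (EuclideanSpace ℝ (Fin m) × EuclideanSpace ℝ (Fin 2)) →L[ℝ] (EuclideanSpace ℝ (Fin m) × EuclideanSpace ℝ (Fin 2)) := fun ζ => Rot (eγ ζ) with hR'def
  set t' : ℂ → EuclideanSpace ℝ (Fin m) × EuclideanSpace ℝ (Fin 2) := fun ζ => (D.Q (D.nearPt ε (eγ ζ)) τ, 0) with ht'def
  have hrange : ∀ ζ, eγ ζ ∈ range D.e := fun ζ => ⟨γ ζ, rfl⟩
  have hP'c : ContinuousOn P' (ball ζ₀ ρ₁) := (hPc.comp heγc.continuousOn fun ζ _ => hrange ζ).mono (subset_univ _)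
  have hR'c : ContinuousOn R' (ball ζ₀ ρ₁) := (hRotc.comp heγc.continuousOn fun ζ _ => hrange ζ).mono (subset_univ _)
  have hP'in : ∀ ζ ∈ ball ζ₀ ρ₁, P' ζ = inOp (D.Q (D.nearPt ε (eγ ζ))) := by
    intro ζ hζ
    show D.planeField J ε δ (eγ ζ) = _
    unfold CodimTwoData.planeField
    rw [if_pos (hin ζ hζ)]
  have ht'c : ContinuousOn t' (ball ζ₀ ρ₁) := ((hnc.mono fun ζ hζ => (hρ₁sub hζ).1.1).clm_apply continuousOn_const).prodMk continuousOn_const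
  have hwc : ContinuousOn w (ball ζ₀ ρ₁) := ((D.continuousOn_wVec hε).comp heγc.continuousOn fun ζ hζ => htube ζ hζ).prodMk continuousOn_const
  have hOPF' : ∀ ζ ∈ ball ζ₀ ρ₁, (∀ v, P' ζ (P' ζ v) = P' ζ v) ∧ (∀ v, P' ζ (R' ζ v) = R' ζ v) ∧ (∀ v, R' ζ (P' ζ v) = R' ζ v) ∧ (∀ v, R' ζ (R' ζ v) = - P' ζ v) ∧
      (∀ v, inner ℝ (R' ζ v).1 (P' ζ v).1 + inner ℝ (R' ζ v).2 (P' ζ v).2 = 0) ∧ (∀ v, inner ℝ (R' ζ v).1 (R' ζ v).1 + inner ℝ (R' ζ v).2 (R' ζ v).2 =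
        inner ℝ (P' ζ v).1 (P' ζ v).1 + inner ℝ (P' ζ v).2 (P' ζ v).2) ∧ P' ζ ≠ 0 ∧ (∀ v w', P' ζ v = v → v ≠ 0 → P' ζ w' = w' →
        w' = ((inner ℝ w'.1 v.1 + inner ℝ w'.2 v.2) / (inner ℝ v.1 v.1 + inner ℝ v.2 v.2)) • v +
          ((inner ℝ w'.1 (R' ζ v).1 + inner ℝ w'.2 (R' ζ v).2) / (inner ℝ v.1 v.1 + inner ℝ v.2 v.2)) • R' ζ v) := fun ζ _ => hOPF (eγ ζ) (hrange ζ)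
  have hfix : ∀ ζ ∈ ball ζ₀ ρ₁, P' ζ (t' ζ) = t' ζ ∧ t' ζ ≠ 0 ∧ P' ζ (w ζ) = w ζ := by
    intro ζ hζ
    refine ⟨?_, ?_, ?_⟩
    · rw [hP'in ζ hζ]
      show ((D.Q (D.nearPt ε (eγ ζ))) (D.Q (D.nearPt ε (eγ ζ)) τ), (0 : EuclideanSpace ℝ (Fin 2))) = _
      rw [D.Q_Q]
    · intro h0
      exact hn0' ζ hζ (congrArg Prod.fst h0)
    · rw [hP'in ζ hζ]
      show ((D.Q (D.nearPt ε (eγ ζ))) (D.wVec ε (eγ ζ)), (0 : EuclideanSpace ℝ (Fin 2))) = _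
      rw [D.Q_wVec]
  obtain ⟨φw, hφw⟩ : ∃ φw : ℂ → ℂ, ∀ ζ, φw ζ = ((inner ℝ (w ζ).1 (t' ζ).1 + inner ℝ (w ζ).2 (t' ζ).2 : ℝ) : ℂ) +
        ((inner ℝ (w ζ).1 (R' ζ (t' ζ)).1 + inner ℝ (w ζ).2 (R' ζ (t' ζ)).2 : ℝ) : ℂ) * Complex.I := ⟨_, fun _ => rfl⟩
  obtain ⟨d, hd⟩ : ∃ d : ℝ, d = (inner ℝ (L₀ 1).1 (t' ζ₀).1 + inner ℝ (L₀ 1).2 (t' ζ₀).2) * (inner ℝ (L₀ Complex.I).1 (R' ζ₀ (t' ζ₀)).1 + inner ℝ (L₀ Complex.I).2 (R' ζ₀ (t' ζ₀)).2) -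
    (inner ℝ (L₀ Complex.I).1 (t' ζ₀).1 + inner ℝ (L₀ Complex.I).2 (t' ζ₀).2) * (inner ℝ (L₀ 1).1 (R' ζ₀ (t' ζ₀)).1 + inner ℝ (L₀ 1).2 (R' ζ₀ (t' ζ₀)).2) := ⟨_, rfl⟩
  have hL₀apply : ∀ h, L₀ h = (D.Q x₀ (A h), 0) := fun h => rfl
  have hL₀fix : ∀ h, P' ζ₀ (L₀ h) = L₀ h := by
    intro h
    rw [hP'in ζ₀ (mem_ball_self hρ₁), hL₀apply]
    show ((D.Q (D.nearPt ε (eγ ζ₀))) (D.Q x₀ (A h)), (0 : EuclideanSpace ℝ (Fin 2))) = _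
    rw [show eγ ζ₀ = D.e (γ ζ₀) from rfl, hx₀near, D.Q_Q]
  obtain ⟨hd0, r₂, hr₂, hr₂ρ, hiso, hwind⟩ := helper_localIndexOfSection m P' R' t' w φw L₀ ζ₀ ρ₁ d hρ₁ hP'c hR'c ht'c hwc hOPF' hfix hφw hwd' hw₀ hL₀inj hL₀fix hd
  -- STEP C: from the transported frame `t'` to the given frame `t`, and from `w` to the section `sec`
  have hr₂ρ₁ : ball ζ₀ r₂ ⊆ ball ζ₀ ρ₁ := ball_subset_ball hr₂ρ.le
  have hwne : ∀ ζ ∈ ball ζ₀ r₂, ζ ≠ ζ₀ → w ζ ≠ 0 := by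
    intro ζ hζ hne hw
    have hφ0 : φw ζ = 0 := by
      rw [hφw ζ, hw]
      simp
    exact hiso ζ (dist_pos.2 hne) (le_of_lt (mem_ball.1 hζ)) hφ0
  obtain ⟨φwt, hφwt⟩ : ∃ φwt : ℂ → ℂ, ∀ ζ, φwt ζ = ((inner ℝ (w ζ).1 (t ζ).1 + inner ℝ (w ζ).2 (t ζ).2 : ℝ) : ℂ) +
        ((inner ℝ (w ζ).1 (R' ζ (t ζ)).1 + inner ℝ (w ζ).2 (R' ζ (t ζ)).2 : ℝ) : ℂ) * Complex.I := ⟨_, fun _ => rfl⟩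
  have hfix2 : ∀ ζ ∈ ball ζ₀ r₂, P' ζ (t' ζ) = t' ζ ∧ t' ζ ≠ 0 ∧ P' ζ (t ζ) = t ζ ∧ t ζ ≠ 0 ∧ P' ζ (w ζ) = w ζ := by
    intro ζ hζ
    obtain ⟨h1, h2, h3⟩ := hfix ζ (hr₂ρ₁ hζ)
    obtain ⟨h4, h5⟩ := ht ζ (hρ₁ρ₀ (hr₂ρ₁ hζ))
    exact ⟨h1, h2, h4, h5, h3⟩
  clear_value P' R' t'
  have hinv : ∀ r : ℝ, 0 < r → r < r₂ → wind (fun θ => φw (circleLoop ζ₀ r θ)) = wind (fun θ => φwt (circleLoop ζ₀ r θ)) :=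
    helper_frameIndexInvariance m P' R' t' t w φw φwt ζ₀ r₂ hr₂ (hP'c.mono hr₂ρ₁) (hR'c.mono hr₂ρ₁) (ht'c.mono hr₂ρ₁) (htc.mono (hr₂ρ₁.trans hρ₁ρ₀)) (hwc.mono hr₂ρ₁)
      (fun ζ hζ => hOPF' ζ (hr₂ρ₁ hζ)) hfix2 hwne hφw hφwt
  -- the section is a positive multiple of `w` off the centre
  have hsecw : ∀ ζ ∈ ball ζ₀ r₂, sec (eγ ζ) = (‖D.wVec ε (eγ ζ)‖⁻¹ : ℝ) • w ζ := by
    intro ζ hζ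
    rw [hSecIn (eγ ζ) (hin ζ (hr₂ρ₁ hζ))]
    show _ = (‖D.wVec ε (eγ ζ)‖⁻¹ : ℝ) • ((D.wVec ε (eγ ζ), (0 : EuclideanSpace ℝ (Fin 2))))
    rw [Prod.smul_mk, smul_zero]
  have hφmul : ∀ ζ ∈ ball ζ₀ r₂, φ ζ = ((‖D.wVec ε (eγ ζ)‖⁻¹ : ℝ) : ℂ) * φwt ζ := by
    intro ζ hζ
    have h1 := hsecw ζ hζ
    rw [hφ ζ, hφwt ζ, hR'def, show D.e (Φ (ζ, s)) = eγ ζ from rfl, h1]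
    simp only [Prod.smul_fst, Prod.smul_snd, inner_smul_left, RCLike.conj_to_real]
    push_cast
    ring
  -- continuity and non-vanishing of the coordinate loops
  have hφwtc : ContinuousOn φwt (ball ζ₀ r₂) := by
    have h1 : ContinuousOn (fun ζ => R' ζ (t ζ)) (ball ζ₀ r₂) := (hR'c.mono hr₂ρ₁).clm_apply (htc.mono (hr₂ρ₁.trans hρ₁ρ₀))
    have hw' := hwc.mono hr₂ρ₁
    have ht'' := htc.mono (hr₂ρ₁.trans hρ₁ρ₀)
    have hre : ContinuousOn (fun ζ => inner ℝ (w ζ).1 (t ζ).1 + inner ℝ (w ζ).2 (t ζ).2) (ball ζ₀ r₂) := ((continuous_fst.comp_continuousOn hw').inner (continuous_fst.comp_continuousOn ht'')).add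
        ((continuous_snd.comp_continuousOn hw').inner (continuous_snd.comp_continuousOn ht''))
    have him : ContinuousOn (fun ζ => inner ℝ (w ζ).1 (R' ζ (t ζ)).1 + inner ℝ (w ζ).2 (R' ζ (t ζ)).2)
        (ball ζ₀ r₂) := ((continuous_fst.comp_continuousOn hw').inner (continuous_fst.comp_continuousOn h1)).add
        ((continuous_snd.comp_continuousOn hw').inner (continuous_snd.comp_continuousOn h1))
    have := (Complex.continuous_ofReal.comp_continuousOn hre).add ((Complex.continuous_ofReal.comp_continuousOn him).mul (continuousOn_const (c := Complex.I)))
    exact this.congr fun ζ _ => hφwt ζ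
  have hφwtne : ∀ ζ ∈ ball ζ₀ r₂, ζ ≠ ζ₀ → φwt ζ ≠ 0 := by
    intro ζ hζ hne
    rw [hφwt ζ]
    obtain ⟨_, _, h4, h5, h3⟩ := hfix2 ζ hζ
    exact HelperFrameIndexInvariance.coord_ne_zero (hOPF' ζ (hr₂ρ₁ hζ)).2.2.2.2.2.2.2 h4 h5 h3 (hwne ζ hζ hne)
  have hwVne : ∀ ζ ∈ ball ζ₀ r₂, ζ ≠ ζ₀ → 0 < ‖D.wVec ε (eγ ζ)‖ := by
    intro ζ hζ hne
    refine norm_pos_iff.2 fun h0 => hwne ζ hζ hne ?_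
    show ((D.wVec ε (eγ ζ), (0 : EuclideanSpace ℝ (Fin 2)))) = 0
    rw [h0]
    rfl
  have hcircle : ∀ r : ℝ, 0 < r → r < r₂ → ∀ θ : ℝ, circleLoop ζ₀ r θ ∈ ball ζ₀ r₂ ∧ circleLoop ζ₀ r θ ≠ ζ₀ := by
    intro r hr hrr θ
    have hd : dist (circleLoop ζ₀ r θ) ζ₀ = r := by rw [dist_eq_norm, norm_circleLoop_sub_center, abs_of_pos hr]
    refine ⟨by rw [mem_ball, hd]; exact hrr, fun h => ?_⟩
    rw [h, dist_self] at hd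
    exact hr.ne' hd.symm |>.elim
  have hwindφ : ∀ r : ℝ, 0 < r → r < r₂ → IsNonvanishingLoop (fun θ => φ (circleLoop ζ₀ r θ)) ∧ wind (fun θ => φ (circleLoop ζ₀ r θ)) = wind (fun θ => φwt (circleLoop ζ₀ r θ)) := by
    intro r hr hrr
    set cl : ℝ → ℂ := fun θ => (((‖D.wVec ε (eγ (circleLoop ζ₀ r θ))‖⁻¹ : ℝ)) : ℂ) with hcl
    have hmem := fun θ => (hcircle r hr hrr θ).1
    have hne := fun θ => (hcircle r hr hrr θ).2
    -- the positive real factor as an exponential loop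
    set l : ℝ → ℂ := fun θ => ((Real.log (‖D.wVec ε (eγ (circleLoop ζ₀ r θ))‖⁻¹) : ℝ) : ℂ) with hl
    have hnc' : Continuous fun θ => ‖D.wVec ε (eγ (circleLoop ζ₀ r θ))‖ := by
      have h1 : ContinuousOn (fun ζ => D.wVec ε (eγ ζ)) (ball ζ₀ r₂) := (D.continuousOn_wVec hε).comp heγc.continuousOn fun ζ hζ => htube ζ (hr₂ρ₁ hζ)
      exact (h1.comp_continuous (continuous_circleLoop ζ₀ r) hmem).norm
    have hposθ : ∀ θ, 0 < ‖D.wVec ε (eγ (circleLoop ζ₀ r θ))‖ := fun θ => hwVne _ (hmem θ) (hne θ)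
    have hlc : Continuous l := Complex.continuous_ofReal.comp ((hnc'.inv₀ fun θ => (hposθ θ).ne').log fun θ => (inv_pos.2 (hposθ θ)).ne')
    have hcl_exp : ∀ θ, cl θ = Complex.exp (l θ) := by
      intro θ
      simp only [hcl, hl]
      rw [← Complex.ofReal_exp, Real.exp_log (inv_pos.2 (hposθ θ))]
    have hcl_wind : wind cl = 0 := by
      rw [wind_congr (f := cl) (g := fun θ => Complex.exp (l θ)) (fun θ _ => hcl_exp θ)]
      exact wind_exp_eq_zero hlc.continuousOn (by simp only [hl, circleLoop_zero_eq])
    have hcl_loop : IsNonvanishingLoop cl := ⟨(Complex.continuous_ofReal.comp (hnc'.inv₀ fun θ => (hposθ θ).ne')).continuousOn, fun θ _ => by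
          simp only [hcl]
          exact_mod_cast (inv_pos.2 (hposθ θ)).ne', by simp only [hcl, circleLoop_zero_eq]⟩
    have hwt_loop : IsNonvanishingLoop (fun θ => φwt (circleLoop ζ₀ r θ)) := ⟨(hφwtc.comp_continuous (continuous_circleLoop ζ₀ r) hmem).continuousOn,
        fun θ _ => hφwtne _ (hmem θ) (hne θ), by simp only [circleLoop_zero_eq]⟩
    have heq : ∀ θ, φ (circleLoop ζ₀ r θ) = cl θ * φwt (circleLoop ζ₀ r θ) := fun θ =>
      hφmul _ (hmem θ)
    refine ⟨?_, ?_⟩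
    · refine ⟨?_, fun θ _ => ?_, ?_⟩
      · exact (hcl_loop.continuousOn.mul hwt_loop.continuousOn).congr fun θ _ => heq θ
      · rw [heq θ]
        exact mul_ne_zero (hcl_loop.ne_zero θ (by assumption)) (hwt_loop.ne_zero θ (by assumption))
      · simp only [heq, hcl, circleLoop_zero_eq]
    · rw [wind_congr (fun θ _ => heq θ), wind_mul hcl_loop hwt_loop, hcl_wind, zero_add]
  -- STEP D: the index of `Σ` against `K` at the crossing, read in the chart `u`
  obtain ⟨ρ₃, hρ₃, hρ₃sub⟩ : ∃ ρ₃ > 0, ball z₀ ρ₃ ⊆ u ⁻¹' UK := Metric.isOpen_iff.1 (hUK.preimage hu.continuous) z₀ hmemUK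
  set α : ℂ →L[ℝ] EuclideanSpace ℝ (Fin 4) := mfderiv 𝓘(ℝ, ℂ) (𝓡 4) u z₀ with hαdef
  have hgu1 : HasMFDerivAt 𝓘(ℝ, ℂ) 𝓘(ℝ, ℂ) (g ∘ u) z₀ (μ.comp α) := hgd.hasMFDerivAt.comp z₀ ((hu z₀).mdifferentiableAt (by simp)).hasMFDerivAt
  have hfd : HasFDerivAt (fun z => g (u z) - s) (μ.comp α) z₀ := (hasMFDerivAt_iff_hasFDerivAt.1 hgu1).sub_const s
  have hf0 : g (u z₀) - s = 0 := by
    rw [← hcross, hgΦ]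
    exact sub_self s
  have hgu_cont : ContinuousOn (fun z => g (u z) - s) (ball z₀ ρ₃) := ((hg.continuousOn.comp hu.continuous.continuousOn fun z hz => hρ₃sub hz).sub continuousOn_const)
  have hsurjμα : Surjective (μ.comp α) := by
    have hmf : mfderiv 𝓘(ℝ, ℂ) 𝓘(ℝ, ℂ) (g ∘ u) z₀ = μ.comp α := hgu1.mfderiv
    intro c
    obtain ⟨a, ha⟩ := hreg c
    refine ⟨a, ?_⟩
    rw [← hmf]
    exact ha
  set q : ℝ := LinearMap.det ((μ.comp α : ℂ →L[ℝ] ℂ) : ℂ →ₗ[ℝ] ℂ) with hqdef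
  have hq0 : q ≠ 0 := by
    have hinj : Injective ((μ.comp α : ℂ →L[ℝ] ℂ) : ℂ →ₗ[ℝ] ℂ) := (LinearMap.injective_iff_surjective (f := ((μ.comp α : ℂ →L[ℝ] ℂ) : ℂ →ₗ[ℝ] ℂ))).2 hsurjμα
    have hunit : IsUnit ((μ.comp α : ℂ →L[ℝ] ℂ) : ℂ →ₗ[ℝ] ℂ) := (LinearMap.isUnit_iff_ker_eq_bot _).2 (LinearMap.ker_eq_bot.2 hinj)
    exact ((LinearMap.isUnit_iff_isUnit_det _).1 hunit).ne_zero
  obtain ⟨r₃, hr₃, _, _, hwind3⟩ := helper_windAtSimpleZero (fun z => g (u z) - s) (μ.comp α) z₀ ρ₃ hρ₃ hgu_cont hfd hf0 hq0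
  -- STEP E: the determinant identity at the crossing
  have hQα : ∀ h, D.Q x₀ (de (α h)) = 0 := by
    intro h
    -- `e ∘ u = f ∘ σ₀`, so `de (du h) = df (dσ₀ h)`
    have hfσ : (fun z => D.e (u z)) = fun z => D.f (CodimTwoData.linePt 0 z) := by
      funext z
      show D.e (u z) = D.e (D.b (CodimTwoData.linePt 0 z))
      rw [hbu]
    have hσ : ContMDiff 𝓘(ℝ, ℂ) (𝓡 2) ∞ (CodimTwoData.linePt 0) := CodimTwoData.contMDiff_linePt 0
    have h1 : HasMFDerivAt 𝓘(ℝ, ℂ) 𝓘(ℝ, EuclideanSpace ℝ (Fin m)) (fun z => D.e (u z)) z₀ (de.comp α) := by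
      have he1 : HasMFDerivAt (𝓡 4) 𝓘(ℝ, EuclideanSpace ℝ (Fin m)) D.e (u z₀) de := by
        rw [hdedef, hbx₀]
        exact (D.mdifferentiableAt_e _).hasMFDerivAt
      exact he1.comp z₀ ((hu z₀).mdifferentiableAt (by simp)).hasMFDerivAt
    have h2' := (D.mdifferentiableAt_f x₀).hasMFDerivAt.comp z₀ ((hσ z₀).mdifferentiableAt (by simp)).hasMFDerivAt
    have h2 : HasMFDerivAt 𝓘(ℝ, ℂ) 𝓘(ℝ, EuclideanSpace ℝ (Fin m)) (fun z => D.f (CodimTwoData.linePt 0 z)) z₀ ((mfderiv (𝓡 2) 𝓘(ℝ, EuclideanSpace ℝ (Fin m)) D.f x₀).comp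
          (mfderiv 𝓘(ℝ, ℂ) (𝓡 2) (CodimTwoData.linePt 0) z₀)) := h2'
    have h1' : HasMFDerivAt 𝓘(ℝ, ℂ) 𝓘(ℝ, EuclideanSpace ℝ (Fin m)) (fun z => D.f (CodimTwoData.linePt 0 z)) z₀
        (de.comp α) := h1.congr_of_eventuallyEq (Filter.Eventually.of_forall fun z => (congrFun hfσ z).symm)
    have h3 := h1'.mfderiv.symm.trans h2.mfderiv
    have h4 : de (α h) = mfderiv (𝓡 2) 𝓘(ℝ, EuclideanSpace ℝ (Fin m)) D.f x₀ (mfderiv 𝓘(ℝ, ℂ) (𝓡 2) (CodimTwoData.linePt 0) z₀ h) := DFunLike.congr_fun h3 h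
    rw [h4]
    exact D.Q_mfderiv_f x₀ _
  have halg := helper_nwtCrossingAlgebra m bE de (D.Q x₀) τ (J x₀ τ) N₁ N₂ α β Lr μ (D.Q_Q x₀) hQτ hQτ' (hJ.inner_apply_self x₀ τ hτF) (hJ.norm_apply x₀ τ hτF) hτ0 hN₁' hN₂' hQα hμβ hμL
  -- identify `d` with the pairing determinant
  have ht'₀ : t' ζ₀ = (τ, 0) := by
    rw [ht'def]
    show ((D.Q (D.nearPt ε (eγ ζ₀))) τ, (0 : EuclideanSpace ℝ (Fin 2))) = (τ, 0)
    rw [show eγ ζ₀ = D.e (γ ζ₀) from rfl, hx₀near, hQτ]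
  have hR'₀ : R' ζ₀ (t' ζ₀) = (J x₀ τ, 0) := by
    rw [hR'def, ht'₀]
    show Rot (eγ ζ₀) (τ, 0) = (J x₀ τ, 0)
    rw [hRotIn (eγ ζ₀) (hin ζ₀ (mem_ball_self hρ₁)), show eγ ζ₀ = D.e (γ ζ₀) from rfl, hx₀near]
    simp only [hQτ]
  have hL₀β : ∀ h, L₀ h = (D.Q x₀ (de (β h)), 0) := fun h => by rw [hL₀apply, hA]
  have hdd : d = inner ℝ (D.Q x₀ (de (β 1))) τ * inner ℝ (D.Q x₀ (de (β Complex.I))) (J x₀ τ) -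
      inner ℝ (D.Q x₀ (de (β Complex.I))) τ * inner ℝ (D.Q x₀ (de (β 1))) (J x₀ τ) := by
    rw [hd, hR'₀, ht'₀, hL₀β, hL₀β]
    simp
  have hiden : d * bE.det ![mfderiv 𝓘(ℝ, ℂ) (𝓡 4) u z₀ (1 : ℂ), mfderiv 𝓘(ℝ, ℂ) (𝓡 4) u z₀ Complex.I, N₁, N₂] =
      ‖τ‖ ^ 4 * (bE.det ![mfderiv 𝓘(ℝ, ℂ × ℂ) (𝓡 4) Φ (ζ₀, s) (1, 0), mfderiv 𝓘(ℝ, ℂ × ℂ) (𝓡 4) Φ (ζ₀, s) (Complex.I, 0),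
          mfderiv 𝓘(ℝ, ℂ × ℂ) (𝓡 4) Φ (ζ₀, s) (0, 1), mfderiv 𝓘(ℝ, ℂ × ℂ) (𝓡 4) Φ (ζ₀, s) (0, Complex.I)] * q) := by
    rw [hdd]
    exact halg
  -- conclusion
  refine ⟨d, q, min (r₂ / 2) r₃, hd0, hq0, lt_min (by positivity) hr₃, hiden, ?_, ?_⟩
  · intro r hr hrle
    have hrr : r < r₂ := lt_of_le_of_lt (hrle.trans (min_le_left _ _)) (by linarith)
    obtain ⟨hloop, hw1⟩ := hwindφ r hr hrr
    refine ⟨hloop, ?_⟩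
    rw [hw1, ← hinv r hr hrr]
    exact (hwind r hr hrr.le).2
  · intro r hr hrle
    exact (hwind3 r hr (hrle.trans (min_le_right _ _))).2

end Summit.SmoothPoincare4.SmoothPoincare4.Theorems.GromovRecognitionRelEnd.CrossCapLaurent

end
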